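import Summits.Ventures.DiscreteObjects.PP12.NoOrder157
import Summits.Ventures.DiscreteObjects.PP12.LiveCells
import Summits.Ventures.DiscreteObjects.PP12.FanoFiveOrbitMatrix

/-!
# PP(12): the Janko–van Trung `{2,3}`-group theorem from three plane-level cell statements (kernel reduction of the named fact)
Framing: lottery ticket; floor = certified bounds/negative ranges.

Cell pub-namedobj (venture DiscreteObjects), target (M), designs gen 15. Every rigid-endgame theorem of the census
(`card_collineationGroup_eq_one_v5 … v9`) takes Janko–van Trung's theorem `CollineationGroupIsTwoThreeGroup` (Literature, named fact: the
full collineation group of a projective plane of order 12 is a `{2,3}`-group) as a hypothesis. The kernel already knows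
(`NoOrder157.prime_mem_of_collineation_order12`) that a collineation `σ ≠ 1` of prime order `p` of such a plane has `p ∈ {2, 3, 5, 11, 13}`.
So, by Cauchy's theorem, the named fact FOLLOWS from the three plane-level cell statements `NoOrderFiveOrder12` (`FanoFiveOrbitMatrix`;
reduced in the kernel to the finite orbit-matrix statements `NoFanoFiveOrbitMatrix` / `NoFanoFiveIncMatrix`, designs g15),
`NoOrderElevenOrder12` and `NoOrderThirteenOrder12` (typed HERE; their array-level forms `NoCollineationOfOrderEleven`, `NoLiftData13` are
typed in `OrderElevenCollineation` / `OrderThirteenCollineation` and decided EMPTY outside the kernel, designs E1; the plane ⇒ array reductions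
are paper proofs, not in the kernel): `collineationGroupIsTwoThreeGroup_of_cells`. In print all three are Janko–van Trung 1981/1982.
Nothing here asserts any cell statement. No `sorry`, no new axioms.
-/

namespace Summit.Ventures.DiscreteObjects.PP12

open Configuration Finset
open scoped Classical

/-- **Census statement at plane level, order-11 cell (typed; in print EXCLUDED, Janko–van Trung 1982; array level `NoCollineationOfOrderEleven`
decided EMPTY outside the kernel, designs E1):** a projective plane of order 12 has no collineation of order 11. -/
def NoOrderElevenOrder12 : Prop :=
  ∀ (P L : Type) [Membership P L] [Fintype P] [Fintype L] [ProjectivePlane P L],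
    ProjectivePlane.order P L = 12 → ∀ σ : Collineation P L, σ.onPoints ^ 11 = 1 → σ.onPoints = 1

/-- **Census statement at plane level, order-13 cell (typed; in print EXCLUDED, Janko–van Trung 1981/1982; array level `NoLiftData13` decided
EMPTY outside the kernel, designs E1):** a projective plane of order 12 has no collineation of order 13. -/
def NoOrderThirteenOrder12 : Prop :=
  ∀ (P L : Type) [Membership P L] [Fintype P] [Fintype L] [ProjectivePlane P L],
    ProjectivePlane.order P L = 12 → ∀ σ : Collineation P L, σ.onPoints ^ 13 = 1 → σ.onPoints = 1

open Literature.Combinatorics.Designs in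
/-- **Janko–van Trung's `{2,3}`-group theorem from the three cell statements `p = 5, 11, 13`** (Cauchy + the kernel prime atlas
`prime_mem_of_collineation_order12`). -/
theorem collineationGroupIsTwoThreeGroup_of_cells (h5 : NoOrderFiveOrder12) (h11 : NoOrderElevenOrder12)
    (h13 : NoOrderThirteenOrder12) : CollineationGroupIsTwoThreeGroup := by
  intro P L _ _ _ _ h12 G _ _ _ _ hG p hp hpd
  haveI : Fact p.Prime := ⟨hp⟩
  obtain ⟨g, hg⟩ := exists_prime_orderOf_dvd_card p hpd
  haveI : FaithfulSMul G P := hG.1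
  set σ := Collineation.ofSMul hG.2 g with hσ
  have hpow : σ.onPoints ^ p = 1 := by
    rw [hσ, Collineation.ofSMul_onPoints, ← MulAction.coe_toPermHom, ← map_pow, ← hg, pow_orderOf_eq_one, map_one]
  have hne : σ.onPoints ≠ 1 := by
    intro h1
    have hg1 : g = 1 := by
      apply MulAction.toPerm_injective (α := G) (β := P)
      rw [hσ, Collineation.ofSMul_onPoints] at h1
      rw [h1]
      ext x; simp
    rw [hg1, orderOf_one] at hg
    exact hp.one_lt.ne' hg.symm
  rcases σ.prime_mem_of_collineation_order12 h12 hne hp hpow with h | h | h | h | h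
  · exact Or.inl h
  · exact Or.inr h
  · subst h; exact (hne (h5 P L h12 σ hpow)).elim
  · subst h; exact (hne (h11 P L h12 σ hpow)).elim
  · subst h; exact (hne (h13 P L h12 σ hpow)).elim

open Literature.Combinatorics.Designs in
/-- **Rigidity from cell statements only (no named fact):** with the three prime cells `p = 5, 11, 13` and the two live cells `p = 2, 3`
(`LiveCells`), every collineation group of a projective plane of order 12 is trivial. -/
theorem card_collineationGroup_eq_one_of_five_cells (h2 : NoInvolutionOrder12) (h3 : NoOrderThreeOrder12) (h5 : NoOrderFiveOrder12)
    (h11 : NoOrderElevenOrder12) (h13 : NoOrderThirteenOrder12)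
    (P L : Type) [Membership P L] [Fintype P] [Fintype L] [ProjectivePlane P L] (h12 : ProjectivePlane.order P L = 12)
    (G : Type) [Group G] [Fintype G] [MulAction G P] [MulAction G L] (hG : IsCollineationGroup G P L) :
    Fintype.card G = 1 :=
  card_collineationGroup_eq_one_of_cells_empty (collineationGroupIsTwoThreeGroup_of_cells h5 h11 h13) h2 h3 P L h12 G hG

end Summit.Ventures.DiscreteObjects.PP12
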